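import Literature.AlgebraicTopology.FundamentalGroup.TopologicalGroupCovering
import Literature.AlgebraicTopology.SingularHomology.LoopClassesSpan
import HarnessLib

/-!
# `H₁` of a homomorphism of compact groups with finite kernel is injective

For a continuous surjective homomorphism `f : G → H` with finite kernel between compact Hausdorff
topological groups (`G` path connected) — a finite covering map (`TopologicalGroupCovering.lean`) —
the induced map `f_* : H₁(G; ℤ) → H₁(H; ℤ)` is injective (`singularHomology_map_one_injective`):
`f_*` is injective on `π₁` (Hatcher, *Algebraic Topology*, Prop. 1.31), and for topological groups
`π₁(·, 1)` is commutative (Eckmann–Hilton), so that the Hurewicz homomorphism `π₁(·, 1) → H₁(·; ℤ)`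
(Hatcher Thm. 2A.1; the tree's `hurewiczOne`, surjective with kernel the commutator subgroup) is an
isomorphism on both sides and is natural (`map_loopClass`).

Also: `injective_hurewiczOne_one` (`π₁(G, 1) → H₁(G; ℤ)` is injective for every path-connected
topological group). Used to compare first Betti numbers of isogenous complex abelian varieties
(towards `Literature.AlgebraicGeometry.Motives.isIso_bettiCohomology_map_abelJacobi`). Everything is
proved; no definitions.

## References

* A. Hatcher, *Algebraic Topology*, CUP 2002, §1.3 Prop. 1.31, §2.A Thm. 2A.1, §3.C Lemma 3C.3.
  [HatcherAT2002]
-/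

noncomputable section

open Function Topology
open Literature.AlgebraicTopology.SingularHomology

universe u

namespace Literature.AlgebraicTopology.FundamentalGroup

/-- **The Hurewicz homomorphism `π₁(G, 1) → H₁(G; ℤ)` of a path-connected topological group is
injective** (its kernel is the commutator subgroup, Hatcher Thm. 2A.1, which is trivial as `π₁(G, 1)`
is commutative, Eckmann–Hilton). [cite: HatcherAT2002, Thm. 2A.1] -/
theorem injective_hurewiczOne_one {G : Type u} [TopologicalSpace G] [Group G] [IsTopologicalGroup G]
    [PathConnectedSpace G] : Injective (hurewiczOne ℤ ℤ (1 : ℤ) (1 : G)) := by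
  rw [← MonoidHom.ker_eq_bot_iff, HurewiczProof.ker_hurewiczOne]
  exact commutator_eq_bot _

variable {G H : Type u} [TopologicalSpace G] [Group G] [IsTopologicalGroup G]
  [CompactSpace G] [T2Space G] [PathConnectedSpace G]
  [TopologicalSpace H] [Group H] [IsTopologicalGroup H] [T2Space H] [PathConnectedSpace H]

/-- **`f_* : H₁(G; ℤ) → H₁(H; ℤ)` is injective** for a continuous surjective homomorphism with finite
kernel from a compact Hausdorff path-connected group onto a Hausdorff path-connected group: on a loop
class `h(γ)`, `f_* h(γ) = h(f ∘ γ)` (naturality), and `h(f ∘ γ) = 0` forces `[f ∘ γ] = 1` in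
`π₁(H, 1)` (Hurewicz injective for groups), hence `[γ] = 1` (`f_*` injective on `π₁`, Hatcher
Prop. 1.31), hence `h(γ) = 0`; loop classes exhaust `H₁(G; ℤ)` (Hatcher Thm. 2A.1).
[cite: HatcherAT2002, §1.3 Prop. 1.31 and Thm. 2A.1] -/
theorem singularHomology_map_one_injective (f : G →* H) (hf : Continuous f) (hsurj : Surjective f)
    (hker : (f.ker : Set G).Finite) :
    Injective (singularHomology.map ℤ ℤ (⟨f, hf⟩ : C(G, H)) 1) := by
  rw [injective_iff_map_eq_zero]
  intro x hx
  -- `x = h(p)` for a loop class `p` at `1`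
  obtain ⟨p, hp⟩ := HurewiczProof.hurewiczOne_surjective (1 : G) (Multiplicative.ofAdd x)
  have hxp : x = Multiplicative.toAdd (hurewiczOne ℤ ℤ (1 : ℤ) (1 : G) p) := by
    rw [hp, toAdd_ofAdd]
  subst hxp
  -- naturality: `f_* h(p) = h(f_* p)` at the base point `f 1`
  have hnat := hurewiczOne_map (R := ℤ) ℤ (1 : ℤ) (⟨f, hf⟩ : C(G, H)) (1 : G) p
  have hq : hurewiczOne ℤ ℤ (1 : ℤ) ((⟨f, hf⟩ : C(G, H)) 1)
      (FundamentalGroup.map (⟨f, hf⟩ : C(G, H)) 1 p) = 1 := by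
    rw [hnat, hx, ofAdd_zero]
  -- the Hurewicz class does not see the base point: `h_{1}(mapOfEq f _ p) = h_{f 1}(map f p)`
  have hbase : hurewiczOne ℤ ℤ (1 : ℤ) (1 : H)
      (FundamentalGroup.mapOfEq (⟨f, hf⟩ : C(G, H)) (map_one f) p) =
      hurewiczOne ℤ ℤ (1 : ℤ) ((⟨f, hf⟩ : C(G, H)) 1) (FundamentalGroup.map (⟨f, hf⟩ : C(G, H)) 1 p) := by
    rw [FundamentalGroup.mapOfEq_apply]
    induction p using Quotient.inductionOn with | h ℓ =>
    change hurewiczOne ℤ ℤ (1 : ℤ) (1 : H) (FundamentalGroup.fromPath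
        (Path.Homotopic.Quotient.mk ((ℓ.map hf).cast (map_one f).symm (map_one f).symm))) =
      hurewiczOne ℤ ℤ (1 : ℤ) (f 1) (FundamentalGroup.fromPath (Path.Homotopic.Quotient.mk (ℓ.map hf)))
    rw [hurewiczOne_fromPath, hurewiczOne_fromPath]
    exact congrArg Multiplicative.ofAdd
      (loopClass_eq_of_ofPath_eq ℤ ℤ (1 : ℤ) ((ℓ.map hf).cast (map_one f).symm (map_one f).symm)
        (ℓ.map hf) rfl)
  have hp1 : FundamentalGroup.mapOfEq (⟨f, hf⟩ : C(G, H)) (map_one f) p = 1 :=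
    injective_hurewiczOne_one (by rw [hbase, hq, map_one])
  have hp0 : p = 1 := mapOfEq_monoidHom_injective f hf hsurj hker (by rw [hp1, map_one])
  rw [hp0, map_one, toAdd_one]

end Literature.AlgebraicTopology.FundamentalGroup

end
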